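import Summits.Ventures.CertifiedManyBodySolver.Observables.PairLROOnePointWitnessTable
import HarnessLib

/-!
# The Koma–Tasaki TOWER witness, part 1 (lemmas): charges, orthogonality, geometric growth and
# energy defect of the tower `A^m ψ`

HONEST FRAMING: first certified bounds on pairing observables; not a superconductivity verdict. Crew
hubbard-obs (D-0042), seat hubbard-obs-p1 (`prover-hubbard-obs-p1-g5-0`). Zero compute; no definition,
no named fact, no `sorry`. Abstract finite-dimensional linear algebra (any `Matrix n n ℂ`).

The two-sector Horsch–von der Linden / KHvdL vector `(ψ + Oψ/‖Oψ‖)/√2` of PairLROOnePointWitness reaches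
only the one-point amplitude `‖Oψ‖/2 ≈ √(u/2)·L²`, whence the ceiling `liminf u ≤ 2M²`. Koma–Tasaki's
construction (J. Stat. Phys. 76 (1994) 745, §2.3 eq. (2.21) and Theorem 5; §4) superposes the whole tower
`Ψ^{(m)} = A^m ψ/‖A^m ψ‖`, `m = 0, …, k`, of a charge-raising operator `A` (`[N, A] = qA`, `q ≠ 0`):
`Ξ^{(k)} = (k+1)^{-1/2} Σ_{m=0}^{k} Ψ^{(m)}`. This file proves, for an ARBITRARY matrix `H` commuting with
the charge `N` and a unit joint eigenvector `ψ` (`Hψ = Eψ`, `Nψ = νψ`), under four quantitative hypotheses —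
`‖Aφ‖ ≤ α‖φ‖`, `‖(HA − AH)φ‖ ≤ κ‖φ‖`, `|Re⟨φ,(AAᴴ − AᴴA)φ⟩| ≤ β‖φ‖²` for all `φ`, and the LRO input
`ρ² + kβ ≤ ‖Aψ‖²` (`ρ > 0`):
* `tower_ratio_lower` — the tower norms grow geometrically: `‖A^{m+1}ψ‖ ≥ ρ‖A^mψ‖` for `m ≤ k`
  (KT 1994 Lemma 12 / eq. (4.17)–(4.20): `a_{m+1}/a_m ≥ a_m/a_{m−1} − β` by Cauchy–Schwarz);
* `tower_energy_defect` — `‖(H − E)A^mψ‖ ≤ D_m‖A^mψ‖`, `D_m = (κ/ρ)Σ_{i<m}(α/ρ)^i`;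
  the witness itself (`exists_towerWitness`: unit `Ξ` with `Re⟨Ξ, AΞ⟩ ≥ kρ/(k+1)`, energy `≤ E + D_k`,
  fillings `γ + g·k/2`) is in PairLROTowerWitness.lean.
For commuting order-operator densities this is KT's Theorem 5 mechanism; the point of the abstract form is
that only the three norm/commutator bounds are used, which hold for NON-commuting bond-pair densities
(`[Δ_b†, Δ_{b'}†] = 0` always; `[Δ, Δ†]` and `[H, Δ†]` are translation sums of local operators). The energy
bound is cruder than KT's `c₁M/N` per site but of the same TOTAL order `O_k(1)`, which is all the
energy-DENSITY row of a variational certificate needs. Consequence (PairLROTowerCeiling): every one-point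
ceiling `M` reads `liminf u ≤ M²` instead of `2M²`.

References: T. Koma, H. Tasaki, J. Stat. Phys. 76 (1994) 745, §2.3 (2.21), Theorem 5, §4 Lemma 12
[KomaTasaki1994]; T. Koma, H. Tasaki, Commun. Math. Phys. 158 (1993) 191, §6–7 [KomaTasaki1993].
-/

noncomputable section

namespace Summit.Ventures.CertifiedManyBodySolver.Observables

open Matrix Complex Finset Literature.MathematicalPhysics.QuantumLattice
open scoped ComplexOrder ComplexConjugate BigOperators

variable {n : Type*} [Fintype n] [DecidableEq n]

/-! ### Small vector-norm helpers -/

omit [DecidableEq n] in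
/-- `Re⟨v, v⟩ = ‖v‖₂²` (real form). [folklore] -/
private theorem re_star_dotProduct_self (v : n → ℂ) : (star v ⬝ᵥ v).re = eucNorm v ^ 2 := (eucNorm_sq v).symm

omit [DecidableEq n] in
/-- `|Re⟨u, v⟩| ≤ ‖u‖₂‖v‖₂`. [folklore] -/
private theorem abs_re_star_dotProduct_le (u v : n → ℂ) : |(star u ⬝ᵥ v).re| ≤ eucNorm u * eucNorm v :=
  (Complex.abs_re_le_norm _).trans (norm_star_dotProduct_le u v)

omit [DecidableEq n] in
/-- The adjoint rule `⟨Au, v⟩ = ⟨u, Aᴴv⟩`. [folklore] -/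
private theorem star_mulVec_dotProduct' (A : Matrix n n ℂ) (u v : n → ℂ) :
    star (A *ᵥ u) ⬝ᵥ v = star u ⬝ᵥ (Aᴴ *ᵥ v) := by
  rw [star_mulVec, ← dotProduct_mulVec]

/-! ### The tower `A^m ψ`: charges, orthogonality, geometric growth, energies -/

section Tower

variable {H Nop A : Matrix n n ℂ} {q : ℝ} {ψ : n → ℂ} {N E : ℝ}

/-- Charges along the tower: `N (A^m ψ) = (ν + q m) A^m ψ`. [cite: KomaTasaki1994, §2.3 (2.16)] -/
theorem tower_charge (hNA : Nop * A - A * Nop = (q : ℂ) • A) (hNψ : Nop *ᵥ ψ = (N : ℂ) • ψ) (m : ℕ) :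
    Nop *ᵥ ((A ^ m) *ᵥ ψ) = ((N + q * m : ℝ) : ℂ) • ((A ^ m) *ᵥ ψ) := by
  induction m with
  | zero => simpa using hNψ
  | succ m ih =>
    rw [pow_succ', ← mulVec_mulVec, mulVec_mulVec_eigen_of_commutator hNA ih]
    congr 1
    push_cast
    ring

/-- Distinct levels of the tower are orthogonal (`N` Hermitian, `q ≠ 0`). [cite: KomaTasaki1994, §2.3] -/
theorem tower_orthogonal (hNop : Nop.IsHermitian) (hq : q ≠ 0) (hNA : Nop * A - A * Nop = (q : ℂ) • A)
    (hNψ : Nop *ᵥ ψ = (N : ℂ) • ψ) {m m' : ℕ} (hmm : m ≠ m') :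
    star ((A ^ m) *ᵥ ψ) ⬝ᵥ ((A ^ m') *ᵥ ψ) = 0 :=
  dotProduct_eq_zero_of_eigen_ne hNop (tower_charge hNA hNψ m) (tower_charge hNA hNψ m') (by
    intro h
    have : (q : ℝ) * ((m : ℝ) - m') = 0 := by linarith
    rcases mul_eq_zero.1 this with h1 | h1
    · exact hq h1
    · exact hmm (by exact_mod_cast sub_eq_zero.1 h1))

/-- `A^{m+1} ψ = A (A^m ψ)`. [folklore] -/
theorem tower_succ (m : ℕ) : (A ^ (m + 1)) *ᵥ ψ = A *ᵥ ((A ^ m) *ᵥ ψ) := by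
  rw [pow_succ', ← mulVec_mulVec]

/-- **Geometric growth of the tower norms** (KT 1994, proof of Lemma 12): with
`|Re⟨φ, (AAᴴ − AᴴA)φ⟩| ≤ β‖φ‖²` for all `φ` and `λ = ‖Aψ‖²`, for every `m`:
`(λ − mβ)·‖A^m ψ‖² ≤ ‖A^{m+1} ψ‖²` as long as `λ − (m−1)β ≥ 0` along the way; stated here under
`ρ² + kβ ≤ λ`, `β ≥ 0`, for all `m ≤ k`: `ρ²‖A^mψ‖² ≤ (λ − mβ)‖A^mψ‖² ≤ ‖A^{m+1}ψ‖²`.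
[cite: KomaTasaki1994, §4 Lemma 12 (4.17)–(4.20)] -/
theorem tower_ratio_lower (hψ1 : star ψ ⬝ᵥ ψ = 1) {β ρ : ℝ} (hβ0 : 0 ≤ β)
    (hβ : ∀ φ : n → ℂ, |(star φ ⬝ᵥ ((A * Aᴴ - Aᴴ * A) *ᵥ φ)).re| ≤ β * eucNorm φ ^ 2)
    (k : ℕ) (hρ2 : ρ ^ 2 + k * β ≤ eucNorm (A *ᵥ ψ) ^ 2) :
    ∀ m : ℕ, m ≤ k →
      (eucNorm (A *ᵥ ψ) ^ 2 - m * β) * eucNorm ((A ^ m) *ᵥ ψ) ^ 2 ≤ eucNorm ((A ^ (m + 1)) *ᵥ ψ) ^ 2 := by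
  set lam := eucNorm (A *ᵥ ψ) ^ 2 with hlam
  set a : ℕ → ℝ := fun m => eucNorm ((A ^ m) *ᵥ ψ) ^ 2 with ha
  have ha0 : a 0 = 1 := by simp [ha, eucNorm_eq_one hψ1]
  have ha1 : a 1 = lam := by simp [ha, hlam]
  have hann : ∀ m, 0 ≤ a m := fun m => by positivity
  -- the Cauchy–Schwarz step: `a_m² ≤ a_{m-1} (a_{m+1} + β a_m)` for `m ≥ 1`
  have hCS : ∀ m : ℕ, a (m + 1) ^ 2 ≤ a m * (a (m + 2) + β * a (m + 1)) := by
    intro m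
    -- `a_{m+1} = Re⟨A^m ψ, Aᴴ A^{m+1} ψ⟩ ≤ ‖A^mψ‖ ‖AᴴA^{m+1}ψ‖`
    have h1 : a (m + 1) = (star ((A ^ m) *ᵥ ψ) ⬝ᵥ (Aᴴ *ᵥ ((A ^ (m + 1)) *ᵥ ψ))).re := by
      simp only [ha]
      rw [← re_star_dotProduct_self, tower_succ m, star_mulVec_dotProduct', ← tower_succ m]
    have h2 : a (m + 1) ≤ eucNorm ((A ^ m) *ᵥ ψ) * eucNorm (Aᴴ *ᵥ ((A ^ (m + 1)) *ᵥ ψ)) := by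
      rw [h1]; exact (le_abs_self _).trans (abs_re_star_dotProduct_le _ _)
    -- `‖AᴴA^{m+1}ψ‖² = a_{m+2} + Re⟨A^{m+1}ψ, (AAᴴ − AᴴA) A^{m+1}ψ⟩ ≤ a_{m+2} + β a_{m+1}`
    have h3 : eucNorm (Aᴴ *ᵥ ((A ^ (m + 1)) *ᵥ ψ)) ^ 2 =
        a (m + 2) + (star ((A ^ (m + 1)) *ᵥ ψ) ⬝ᵥ ((A * Aᴴ - Aᴴ * A) *ᵥ ((A ^ (m + 1)) *ᵥ ψ))).re := by
      have e1 : eucNorm (Aᴴ *ᵥ ((A ^ (m + 1)) *ᵥ ψ)) ^ 2 =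
          (star ((A ^ (m + 1)) *ᵥ ψ) ⬝ᵥ ((A * Aᴴ) *ᵥ ((A ^ (m + 1)) *ᵥ ψ))).re := by
        rw [← re_star_dotProduct_self, star_mulVec_dotProduct', conjTranspose_conjTranspose, mulVec_mulVec]
      have e2 : a (m + 2) = (star ((A ^ (m + 1)) *ᵥ ψ) ⬝ᵥ ((Aᴴ * A) *ᵥ ((A ^ (m + 1)) *ᵥ ψ))).re := by
        simp only [ha]
        rw [← re_star_dotProduct_self, show m + 2 = (m + 1) + 1 from rfl, tower_succ (m + 1),
          star_mulVec_dotProduct', mulVec_mulVec]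
      rw [e1, e2, ← Complex.add_re, ← dotProduct_add, ← add_mulVec, add_sub_cancel]
    have h4 : eucNorm (Aᴴ *ᵥ ((A ^ (m + 1)) *ᵥ ψ)) ^ 2 ≤ a (m + 2) + β * a (m + 1) := by
      rw [h3]
      have := (le_abs_self _).trans (hβ ((A ^ (m + 1)) *ᵥ ψ))
      simp only [ha]
      linarith
    have h5 : a (m + 1) ^ 2 ≤ (eucNorm ((A ^ m) *ᵥ ψ) * eucNorm (Aᴴ *ᵥ ((A ^ (m + 1)) *ᵥ ψ))) ^ 2 :=
      pow_le_pow_left₀ (hann _) h2 2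
    calc a (m + 1) ^ 2 ≤ eucNorm ((A ^ m) *ᵥ ψ) ^ 2 * eucNorm (Aᴴ *ᵥ ((A ^ (m + 1)) *ᵥ ψ)) ^ 2 := by
          rw [← mul_pow]; exact h5
      _ ≤ a m * (a (m + 2) + β * a (m + 1)) := by
          exact mul_le_mul_of_nonneg_left h4 (hann m)
  -- induction on `m`
  intro m hm
  induction m with
  | zero => simp [eucNorm_eq_one hψ1, hlam]
  | succ m ih =>
    have ih' := ih (Nat.le_of_succ_le hm)
    -- positivity of the coefficient used
    have hcoef : 0 ≤ lam - m * β := by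
      have : (m : ℝ) * β ≤ k * β := mul_le_mul_of_nonneg_right (by exact_mod_cast Nat.le_of_succ_le hm) hβ0
      nlinarith [sq_nonneg ρ]
    have hcs := hCS m
    change (lam - ((m + 1 : ℕ) : ℝ) * β) * a (m + 1) ≤ a (m + 1 + 1)
    change (lam - (m : ℝ) * β) * a m ≤ a (m + 1) at ih'
    -- multiply the CS inequality by the coefficient and use the induction hypothesis
    have h6 : (lam - m * β) * a (m + 1) ^ 2 ≤ a (m + 1) * (a (m + 2) + β * a (m + 1)) := by
      calc (lam - m * β) * a (m + 1) ^ 2 ≤ (lam - m * β) * (a m * (a (m + 2) + β * a (m + 1))) :=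
            mul_le_mul_of_nonneg_left hcs hcoef
        _ = ((lam - m * β) * a m) * (a (m + 2) + β * a (m + 1)) := by ring
        _ ≤ a (m + 1) * (a (m + 2) + β * a (m + 1)) :=
            mul_le_mul_of_nonneg_right ih' (by nlinarith [hann (m + 2), hann (m + 1)])
    rcases (hann (m + 1)).lt_or_eq with hpos | hzero
    · have h7 : (lam - m * β) * a (m + 1) ≤ a (m + 2) + β * a (m + 1) := by
        have : a (m + 1) * ((lam - m * β) * a (m + 1)) ≤ a (m + 1) * (a (m + 2) + β * a (m + 1)) := by
          nlinarith
        exact le_of_mul_le_mul_left this hpos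
      push_cast
      nlinarith
    · rw [← hzero]
      simp only [mul_zero]
      exact hann _

/-- **Geometric growth, ratio form**: under `ρ² + kβ ≤ ‖Aψ‖²`, `ρ > 0`, `β ≥ 0`: `ρ‖A^mψ‖ ≤ ‖A^{m+1}ψ‖`
for `m ≤ k`, hence every level `m ≤ k + 1` of the tower is nonzero and `ρ^{m−j}‖A^jψ‖ ≤ ‖A^mψ‖`.
[cite: KomaTasaki1994, §4 Lemma 12] -/
theorem tower_geom (hψ1 : star ψ ⬝ᵥ ψ = 1) {β ρ : ℝ} (hβ0 : 0 ≤ β) (hρ : 0 < ρ)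
    (hβ : ∀ φ : n → ℂ, |(star φ ⬝ᵥ ((A * Aᴴ - Aᴴ * A) *ᵥ φ)).re| ≤ β * eucNorm φ ^ 2)
    (k : ℕ) (hρ2 : ρ ^ 2 + k * β ≤ eucNorm (A *ᵥ ψ) ^ 2) :
    (∀ m : ℕ, m ≤ k → ρ * eucNorm ((A ^ m) *ᵥ ψ) ≤ eucNorm ((A ^ (m + 1)) *ᵥ ψ)) ∧
    (∀ m : ℕ, m ≤ k + 1 → 0 < eucNorm ((A ^ m) *ᵥ ψ)) := by
  have hrat := tower_ratio_lower (A := A) hψ1 hβ0 hβ k hρ2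
  have hstep : ∀ m : ℕ, m ≤ k → ρ * eucNorm ((A ^ m) *ᵥ ψ) ≤ eucNorm ((A ^ (m + 1)) *ᵥ ψ) := by
    intro m hm
    have h1 := hrat m hm
    have hcoef : ρ ^ 2 ≤ eucNorm (A *ᵥ ψ) ^ 2 - m * β := by
      have : (m : ℝ) * β ≤ k * β := mul_le_mul_of_nonneg_right (by exact_mod_cast hm) hβ0
      linarith
    have h2 : (ρ * eucNorm ((A ^ m) *ᵥ ψ)) ^ 2 ≤ eucNorm ((A ^ (m + 1)) *ᵥ ψ) ^ 2 := by
      rw [mul_pow]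
      exact (mul_le_mul_of_nonneg_right hcoef (sq_nonneg _)).trans h1
    exact pow_le_pow_iff_left₀ (mul_nonneg hρ.le (eucNorm_nonneg _)) (eucNorm_nonneg _) two_ne_zero |>.1 h2
  refine ⟨hstep, ?_⟩
  intro m hm
  induction m with
  | zero => simp [eucNorm_eq_one hψ1]
  | succ m ih =>
    have h := hstep m (by omega)
    have hp := ih (by omega)
    exact lt_of_lt_of_le (mul_pos hρ hp) h

/-- **Energy defect along the tower.** With `Hψ = Eψ`, `‖Aφ‖ ≤ α‖φ‖`, `‖(HA − AH)φ‖ ≤ κ‖φ‖` and the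
geometric growth of `tower_geom`: `‖(H − E)A^mψ‖ ≤ D_m ‖A^mψ‖` for `m ≤ k`, `D_m = (κ/ρ) Σ_{i<m} (α/ρ)^i`
(`(H − E)A^{m+1}ψ = (HA − AH)A^mψ + A (H − E)A^mψ`). KT 1994 §4 obtains the sharper `c₁ m` by their
Lemma 12; this crude form suffices for energy DENSITIES. [cite: KomaTasaki1994, §4 (4.8)–(4.13)] -/
theorem tower_energy_defect (hψ1 : star ψ ⬝ᵥ ψ = 1) (hHψ : H *ᵥ ψ = (E : ℂ) • ψ)
    {α κ β ρ : ℝ} (hα0 : 0 ≤ α) (hα : ∀ φ : n → ℂ, eucNorm (A *ᵥ φ) ≤ α * eucNorm φ)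
    (hκ0 : 0 ≤ κ) (hκ : ∀ φ : n → ℂ, eucNorm ((H * A - A * H) *ᵥ φ) ≤ κ * eucNorm φ)
    (hβ0 : 0 ≤ β) (hρ : 0 < ρ)
    (hβ : ∀ φ : n → ℂ, |(star φ ⬝ᵥ ((A * Aᴴ - Aᴴ * A) *ᵥ φ)).re| ≤ β * eucNorm φ ^ 2)
    (k : ℕ) (hρ2 : ρ ^ 2 + k * β ≤ eucNorm (A *ᵥ ψ) ^ 2) :
    ∀ m : ℕ, m ≤ k →
      eucNorm (H *ᵥ ((A ^ m) *ᵥ ψ) - (E : ℂ) • ((A ^ m) *ᵥ ψ)) ≤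
        ((κ / ρ) * ∑ i ∈ Finset.range m, (α / ρ) ^ i) * eucNorm ((A ^ m) *ᵥ ψ) := by
  obtain ⟨hstep, hpos⟩ := tower_geom (A := A) hψ1 hβ0 hρ hβ k hρ2
  intro m hm
  induction m with
  | zero => simp [hHψ]
  | succ m ih =>
    have ih' := ih (Nat.le_of_succ_le hm)
    set D : ℝ := (κ / ρ) * ∑ i ∈ Finset.range m, (α / ρ) ^ i with hD
    have hDnn : 0 ≤ D := mul_nonneg (div_nonneg hκ0 hρ.le) (Finset.sum_nonneg fun i _ => by positivity)
    -- the recursion `(H − E)A^{m+1}ψ = (HA − AH)A^mψ + A((H − E)A^mψ)`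
    have hrec : H *ᵥ ((A ^ (m + 1)) *ᵥ ψ) - (E : ℂ) • ((A ^ (m + 1)) *ᵥ ψ) =
        (H * A - A * H) *ᵥ ((A ^ m) *ᵥ ψ) + A *ᵥ (H *ᵥ ((A ^ m) *ᵥ ψ) - (E : ℂ) • ((A ^ m) *ᵥ ψ)) := by
      rw [tower_succ m, mulVec_mulVec, sub_mulVec, mulVec_sub, mulVec_smul, ← mulVec_mulVec, ← mulVec_mulVec]
      abel
    have h1 : eucNorm (H *ᵥ ((A ^ (m + 1)) *ᵥ ψ) - (E : ℂ) • ((A ^ (m + 1)) *ᵥ ψ)) ≤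
        κ * eucNorm ((A ^ m) *ᵥ ψ) + α * (D * eucNorm ((A ^ m) *ᵥ ψ)) := by
      rw [hrec]
      refine (eucNorm_add_le _ _).trans (add_le_add (hκ _) ((hα _).trans ?_))
      exact mul_le_mul_of_nonneg_left ih' hα0
    -- `nr m ≤ nr (m+1)/ρ`
    have h2 : eucNorm ((A ^ m) *ᵥ ψ) ≤ eucNorm ((A ^ (m + 1)) *ᵥ ψ) / ρ := by
      rw [le_div_iff₀ hρ, mul_comm]; exact hstep m (Nat.le_of_succ_le hm)
    -- `D_{m+1} = (κ + α D_m)/ρ`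
    have hD' : (κ / ρ) * ∑ i ∈ Finset.range (m + 1), (α / ρ) ^ i = (κ + α * D) / ρ := by
      rw [Finset.sum_range_succ', pow_zero, hD]
      simp_rw [pow_succ]
      rw [← Finset.sum_mul]
      field_simp
      ring
    rw [hD']
    calc eucNorm (H *ᵥ ((A ^ (m + 1)) *ᵥ ψ) - (E : ℂ) • ((A ^ (m + 1)) *ᵥ ψ))
        ≤ κ * eucNorm ((A ^ m) *ᵥ ψ) + α * (D * eucNorm ((A ^ m) *ᵥ ψ)) := h1
      _ = (κ + α * D) * eucNorm ((A ^ m) *ᵥ ψ) := by ring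
      _ ≤ (κ + α * D) * (eucNorm ((A ^ (m + 1)) *ᵥ ψ) / ρ) :=
          mul_le_mul_of_nonneg_left h2 (by positivity)
      _ = (κ + α * D) / ρ * eucNorm ((A ^ (m + 1)) *ᵥ ψ) := by ring

omit [DecidableEq n] in
/-- Bilinear expansion of `⟨Σ wᵢ, X Σ wⱼ⟩`. [folklore] -/
theorem star_sum_dotProduct_mulVec_sum {ι : Type*} (s : Finset ι) (w : ι → n → ℂ) (X : Matrix n n ℂ) :
    star (∑ i ∈ s, w i) ⬝ᵥ (X *ᵥ ∑ j ∈ s, w j) = ∑ i ∈ s, ∑ j ∈ s, star (w i) ⬝ᵥ (X *ᵥ w j) := by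
  rw [mulVec_sum, star_sum, sum_dotProduct]
  exact Finset.sum_congr rfl fun i _ => dotProduct_sum _ _ _

end Tower

end Summit.Ventures.CertifiedManyBodySolver.Observables

end
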